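import Mathlib
import HarnessLib.Audit
import Summits.PneNP.PneNP.Theorems.PstarForcing

/-!
# Products of two affine functions against a rank-four quadratic: vanishing affine functions, degenerate products, shifts (O2 / E1; prover-1 g23)

FRONTIER range-avoidance ladder, rung F-N3 (`stmt-PneNP-19007`), cell `pnp-ideate`; restricted-model proof complexity — nothing here bears on `P` versus `NP`.

Generic algebra over an `𝔽₂`-module `M` for the PRODUCT rows of the blind-cross-gate nodes (`PstarCrossCaseU2.qDir10_cases` / `qDir01_cases`,
`PstarRankRigidityFour.classification`): a quadratic `Q` of rank `≥ 4` (polar identity with `B`, `dim rad B + 4 ≤ dim M`) and a product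
`μ₁ μ₂` of two affine functions vanishing on `Z(Q)`.

* `affine_eq_zero_of_vanish` — an AFFINE function vanishing on `Z(Q)` is `0` (`PstarForcing.not_forced_of_affine` read contrapositively);
* `isAffineFn_mul_of_degenerate`, `mul_eq_zero_of_degenerate` — if a linear part vanishes or the two linear parts agree, the product is affine,
  hence `0` on vanishing: only NON-DEGENERATE products (both linear parts non-zero and distinct) give genuine product rows;
* `exists_eq_one_one` — a non-degenerate pair takes the value `(1, 1)` somewhere (the product is not identically zero);
* `shift_of_vanish` — **a translation `z` fixing `Q` fixes both factors of a non-degenerate vanishing product** (`μᵢ z = μᵢ 0`): in coordinates,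
  the supports of the linear parts lie inside the variables `Q` reads;
* `affine_expand` — coordinate expansion `μ x = μ 0 + Σ_i x_i · (μ e_i + μ 0)` of an affine function on `ι → 𝔽₂`.
-/

set_option linter.dupNamespace false -- `Summit.PneNP.PneNP.…`: summit = sub-problem name (D-0017 single-conjunct layout)

open Finset Module
open Summit.PneNP.PneNP.Theorems.PstarCubeIdeals (IsAffineFn IsQuadFn)
open Summit.PneNP.PneNP.Theorems.PstarQuadRank (rad)
open Summit.PneNP.PneNP.Theorems.PstarRankRigidityTwo (linPart linPart_apply)
open Summit.PneNP.PneNP.Theorems.PstarForcing (not_forced_of_affine)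

namespace Summit.PneNP.PneNP.Theorems.PstarCrossProductAlgebra

/-- Every element of `𝔽₂` is `0` or `1`. -/
private theorem zmod2_cases (t : ZMod 2) : t = 0 ∨ t = 1 := by
  revert t; decide

variable {M : Type*} [AddCommGroup M] [Module (ZMod 2) M] [Fintype M] [DecidableEq M]

omit [DecidableEq M] in
/-- **An affine function vanishing on the zero set of a rank-four quadratic is zero.**  (Where `α = 1` the quadratic `Q` is `1`, i.e. `Q` is constant
on `Z(α + 1)` with `α + 1` affine: `PstarForcing.not_forced_of_affine` gives `α + 1 ≡ 1`.) -/
theorem affine_eq_zero_of_vanish {Q : M → ZMod 2} {B : LinearMap.BilinForm (ZMod 2) M} (hB : ∀ x w, Q (x + w) = Q x + Q w + Q 0 + B x w)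
    (hrank : finrank (ZMod 2) (rad B) + 4 ≤ finrank (ZMod 2) M) {α : M → ZMod 2} (hα : IsAffineFn α) (hZ : ∀ x, Q x = 0 → α x = 0) :
    ∀ x, α x = 0 := by
  have hq : IsAffineFn (fun x => α x + 1) := fun x w => by
    show α (x + w) + 1 = α x + 1 + (α w + 1) + (α 0 + 1)
    rw [hα x w]
    generalize α x = a; generalize α w = b; generalize α 0 = c
    revert a b c; decide
  have h := not_forced_of_affine hq hB hrank (c := 1) fun x hx => by
    rcases zmod2_cases (Q x) with h0 | h1
    · have := hZ x h0
      rw [this] at hx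
      exact absurd hx (by decide)
    · exact h1
  intro x
  have e : ∀ a : ZMod 2, a + 1 = 1 → a = 0 := by decide
  exact e _ (h x)

omit [Module (ZMod 2) M] [Fintype M] [DecidableEq M] in
/-- A DEGENERATE product of affine functions (a constant factor, or equal linear parts) is affine. -/
theorem isAffineFn_mul_of_degenerate {μ₁ μ₂ : M → ZMod 2} (h₁ : IsAffineFn μ₁) (h₂ : IsAffineFn μ₂)
    (h : (∀ z, μ₁ z = μ₁ 0) ∨ (∀ z, μ₂ z = μ₂ 0) ∨ (∀ z, μ₁ z + μ₁ 0 = μ₂ z + μ₂ 0)) :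
    IsAffineFn fun x => μ₁ x * μ₂ x := by
  intro x w
  show μ₁ (x + w) * μ₂ (x + w) = μ₁ x * μ₂ x + μ₁ w * μ₂ w + μ₁ 0 * μ₂ 0
  rcases h with h | h | h
  · rw [h (x + w), h x, h w, h₂ x w]
    generalize μ₁ 0 = a; generalize μ₂ x = b; generalize μ₂ w = c; generalize μ₂ 0 = d
    revert a b c d; decide
  · rw [h (x + w), h x, h w, h₁ x w]
    generalize μ₂ 0 = a; generalize μ₁ x = b; generalize μ₁ w = c; generalize μ₁ 0 = d
    revert a b c d; decide
  · have h' : ∀ z, μ₂ z = μ₁ z + (μ₁ 0 + μ₂ 0) := fun z => by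
      have e : ∀ a b c d : ZMod 2, a + b = c + d → c = a + (b + d) := by decide
      exact e _ _ _ _ (h z)
    rw [h' (x + w), h' x, h' w, h₁ x w]
    generalize μ₁ x = a; generalize μ₁ w = b; generalize μ₁ 0 = c; generalize μ₂ 0 = d
    revert a b c d; decide

omit [DecidableEq M] in
/-- **A degenerate product vanishing on `Z(Q)` is identically zero** (rank `Q ≥ 4`). -/
theorem mul_eq_zero_of_degenerate {Q : M → ZMod 2} {B : LinearMap.BilinForm (ZMod 2) M} (hB : ∀ x w, Q (x + w) = Q x + Q w + Q 0 + B x w)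
    (hrank : finrank (ZMod 2) (rad B) + 4 ≤ finrank (ZMod 2) M) {μ₁ μ₂ : M → ZMod 2} (h₁ : IsAffineFn μ₁) (h₂ : IsAffineFn μ₂)
    (h : (∀ z, μ₁ z = μ₁ 0) ∨ (∀ z, μ₂ z = μ₂ 0) ∨ (∀ z, μ₁ z + μ₁ 0 = μ₂ z + μ₂ 0)) (hZ : ∀ x, Q x = 0 → μ₁ x * μ₂ x = 0) :
    ∀ x, μ₁ x * μ₂ x = 0 :=
  affine_eq_zero_of_vanish hB hrank (isAffineFn_mul_of_degenerate h₁ h₂ h) hZ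

omit [Fintype M] [DecidableEq M] in
/-- **A non-degenerate pair of affine functions takes every pair of values**; in particular the value `(1, 1)`. -/
theorem exists_eq_one_one {μ₁ μ₂ : M → ZMod 2} (h₁ : IsAffineFn μ₁) (h₂ : IsAffineFn μ₂)
    (hn₁ : ∃ z, μ₁ z ≠ μ₁ 0) (hn₂ : ∃ z, μ₂ z ≠ μ₂ 0) (hn : ∃ z, μ₁ z + μ₁ 0 ≠ μ₂ z + μ₂ 0) (c₁ c₂ : ZMod 2) :
    ∃ y, μ₁ y = c₁ ∧ μ₂ y = c₂ := by
  set L₁ := linPart h₁ with hL₁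
  set L₂ := linPart h₂ with hL₂
  have eL₁ : ∀ z, μ₁ z = L₁ z + μ₁ 0 := fun z => by
    rw [hL₁, linPart_apply]; generalize μ₁ z = a; generalize μ₁ 0 = b; revert a b; decide
  have eL₂ : ∀ z, μ₂ z = L₂ z + μ₂ 0 := fun z => by
    rw [hL₂, linPart_apply]; generalize μ₂ z = a; generalize μ₂ 0 = b; revert a b; decide
  -- it suffices to prescribe the linear parts
  suffices hs : ∀ d₁ d₂ : ZMod 2, ∃ y, L₁ y = d₁ ∧ L₂ y = d₂ by
    obtain ⟨y, hy₁, hy₂⟩ := hs (c₁ + μ₁ 0) (c₂ + μ₂ 0)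
    have e3 : ∀ c a : ZMod 2, c + a + a = c := by decide
    refine ⟨y, ?_, ?_⟩
    · rw [eL₁, hy₁]; exact e3 _ _
    · rw [eL₂, hy₂]; exact e3 _ _
  obtain ⟨r, hr⟩ := hn
  have hr' : L₁ r ≠ L₂ r := by rwa [hL₁, hL₂, linPart_apply, linPart_apply]
  have ne0 : ∀ a : ZMod 2, a ≠ 0 → a = 1 := by decide
  have e2 : ∀ a b : ZMod 2, a + b = 0 → a = b := by decide
  intro d₁ d₂
  rcases zmod2_cases (L₁ r) with h0 | h1
  · -- `L₁ r = 0`, `L₂ r = 1`; a vector `s` with `L₁ s = 1`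
    have h1' : L₂ r = 1 := ne0 _ fun h => hr' (by rw [h0, h])
    obtain ⟨s, hs⟩ := hn₁
    have hs' : L₁ s = 1 := ne0 _ (by rw [hL₁, linPart_apply]; exact fun e => hs (e2 _ _ e))
    refine ⟨d₁ • s + (d₂ + d₁ * L₂ s) • r, ?_, ?_⟩
    · rw [map_add, map_smul, map_smul, smul_eq_mul, smul_eq_mul, hs', h0]; ring
    · rw [map_add, map_smul, map_smul, smul_eq_mul, smul_eq_mul, h1']
      generalize L₂ s = a; revert a d₁ d₂; decide
  · have h0' : L₂ r = 0 := by
      rcases zmod2_cases (L₂ r) with h | h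
      · exact h
      · exact absurd (h1.trans h.symm) hr'
    obtain ⟨s, hs⟩ := hn₂
    have hs' : L₂ s = 1 := ne0 _ (by rw [hL₂, linPart_apply]; exact fun e => hs (e2 _ _ e))
    refine ⟨d₂ • s + (d₁ + d₂ * L₁ s) • r, ?_, ?_⟩
    · rw [map_add, map_smul, map_smul, smul_eq_mul, smul_eq_mul, h1]
      generalize L₁ s = a; revert a d₁ d₂; decide
    · rw [map_add, map_smul, map_smul, smul_eq_mul, smul_eq_mul, hs', h0']; ring

omit [DecidableEq M] in
/-- **A translation fixing `Q` fixes both factors of a non-degenerate vanishing product.**  If `μ₁ μ₂` (non-degenerate) vanishes on `Z(Q)` (rank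
`≥ 4`) and `Q (x + z) = Q x` for all `x`, then `μ₁ z = μ₁ 0` and `μ₂ z = μ₂ 0`: otherwise comparing the product at `x` and `x + z` on `Z(Q)` makes
`μ₂`, `μ₁`, or `μ₁ + μ₂ + 1` an affine function vanishing on `Z(Q)`, i.e. zero (`affine_eq_zero_of_vanish`), contradicting non-degeneracy. -/
theorem shift_of_vanish {Q : M → ZMod 2} {B : LinearMap.BilinForm (ZMod 2) M} (hB : ∀ x w, Q (x + w) = Q x + Q w + Q 0 + B x w)
    (hrank : finrank (ZMod 2) (rad B) + 4 ≤ finrank (ZMod 2) M) {μ₁ μ₂ : M → ZMod 2} (h₁ : IsAffineFn μ₁) (h₂ : IsAffineFn μ₂)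
    (hn₁ : ∃ z, μ₁ z ≠ μ₁ 0) (hn₂ : ∃ z, μ₂ z ≠ μ₂ 0) (hn : ∃ z, μ₁ z + μ₁ 0 ≠ μ₂ z + μ₂ 0)
    (hZ : ∀ x, Q x = 0 → μ₁ x * μ₂ x = 0) {z : M} (hz : ∀ x, Q (x + z) = Q x) : μ₁ z = μ₁ 0 ∧ μ₂ z = μ₂ 0 := by
  -- on `Z(Q)` both `x` and `x + z` are zeros of the product
  have hpair : ∀ x, Q x = 0 → μ₁ x * μ₂ x = 0 ∧ (μ₁ x + (μ₁ z + μ₁ 0)) * (μ₂ x + (μ₂ z + μ₂ 0)) = 0 := fun x hx => by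
    refine ⟨hZ x hx, ?_⟩
    have h := hZ (x + z) (by rw [hz x, hx])
    rwa [h₁ x z, h₂ x z, add_assoc, add_assoc] at h
  have eq_of : ∀ a b : ZMod 2, a + b = 0 → a = b := by decide
  rcases zmod2_cases (μ₁ z + μ₁ 0) with ha | ha <;> rcases zmod2_cases (μ₂ z + μ₂ 0) with hb | hb
  · exact ⟨eq_of _ _ ha, eq_of _ _ hb⟩
  · -- `(0,1)`: `μ₁` vanishes on `Z(Q)`
    exfalso
    have hv : ∀ x, Q x = 0 → μ₁ x = 0 := fun x hx => by
      obtain ⟨e1, e2⟩ := hpair x hx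
      rw [ha, hb] at e2
      revert e1 e2; generalize μ₁ x = a; generalize μ₂ x = b; revert a b; decide
    have h0 := affine_eq_zero_of_vanish hB hrank h₁ hv
    obtain ⟨s, hs⟩ := hn₁
    exact hs (by rw [h0 s, h0 0])
  · -- `(1,0)`: `μ₂` vanishes on `Z(Q)`
    exfalso
    have hv : ∀ x, Q x = 0 → μ₂ x = 0 := fun x hx => by
      obtain ⟨e1, e2⟩ := hpair x hx
      rw [ha, hb] at e2
      revert e1 e2; generalize μ₁ x = a; generalize μ₂ x = b; revert a b; decide
    have h0 := affine_eq_zero_of_vanish hB hrank h₂ hv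
    obtain ⟨s, hs⟩ := hn₂
    exact hs (by rw [h0 s, h0 0])
  · -- `(1,1)`: `μ₁ + μ₂ + 1` vanishes on `Z(Q)`
    exfalso
    have hα : IsAffineFn fun x => μ₁ x + μ₂ x + 1 := fun x w => by
      show μ₁ (x + w) + μ₂ (x + w) + 1 = μ₁ x + μ₂ x + 1 + (μ₁ w + μ₂ w + 1) + (μ₁ 0 + μ₂ 0 + 1)
      rw [h₁ x w, h₂ x w]
      generalize μ₁ x = a; generalize μ₁ w = b; generalize μ₁ 0 = c
      generalize μ₂ x = a'; generalize μ₂ w = b'; generalize μ₂ 0 = c'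
      revert a b c a' b' c'; decide
    have hv : ∀ x, Q x = 0 → μ₁ x + μ₂ x + 1 = 0 := fun x hx => by
      obtain ⟨e1, e2⟩ := hpair x hx
      rw [ha, hb] at e2
      revert e1 e2; generalize μ₁ x = a; generalize μ₂ x = b; revert a b; decide
    have h0 := affine_eq_zero_of_vanish hB hrank hα hv
    obtain ⟨s, hs⟩ := hn
    have hs0 := h0 s
    have h00 := h0 0
    apply hs
    revert hs0 h00
    generalize μ₁ s = a; generalize μ₂ s = b; generalize μ₁ 0 = c; generalize μ₂ 0 = d
    revert a b c d; decide

/-! ## Coordinates -/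

/-- **Coordinate expansion of an affine function** on `ι → 𝔽₂`: `μ x = μ 0 + Σ_i x_i · (μ e_i + μ 0)`. -/
theorem affine_expand {ι : Type*} [Fintype ι] [DecidableEq ι] {μ : (ι → ZMod 2) → ZMod 2} (hμ : IsAffineFn μ) (x : ι → ZMod 2) :
    μ x = μ 0 + ∑ i, x i * (μ (Pi.single i 1) + μ 0) := by
  have h := LinearMap.pi_apply_eq_sum_univ (linPart hμ) x
  rw [linPart_apply] at h
  have hsingle : ∀ i : ι, (fun j => if i = j then (1 : ZMod 2) else 0) = Pi.single i 1 := fun i => by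
    funext j
    rw [Pi.single_apply]
    by_cases hij : i = j
    · rw [if_pos hij, if_pos hij.symm]
    · rw [if_neg hij, if_neg (Ne.symm hij)]
  simp only [hsingle, linPart_apply, smul_eq_mul] at h
  have e : ∀ a b c : ZMod 2, a + b = c → a = b + c := by decide
  exact e _ _ _ h

/-- **An affine function whose linear part vanishes at every coordinate outside `W` depends only on the coordinates in `W`.** -/
theorem affine_eq_of_agree {ι : Type*} [Fintype ι] [DecidableEq ι] {μ : (ι → ZMod 2) → ZMod 2} (hμ : IsAffineFn μ) {W : Finset ι}
    (hW : ∀ i, i ∉ W → μ (Pi.single i 1) = μ 0) {x x' : ι → ZMod 2} (hx : ∀ i ∈ W, x i = x' i) : μ x = μ x' := by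
  rw [affine_expand hμ x, affine_expand hμ x']
  congr 1
  refine sum_congr rfl fun i _ => ?_
  by_cases hi : i ∈ W
  · rw [hx i hi]
  · rw [hW i hi, CharTwo.add_self_eq_zero, mul_zero, mul_zero]

end Summit.PneNP.PneNP.Theorems.PstarCrossProductAlgebra
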